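import Summits.QuantumFields.BalabanUV.Beta.WardLocusCombSecondOrder
import Summits.QuantumFields.BalabanUV.Beta.WardLocusParitySplit
import Summits.QuantumFields.BalabanUV.Beta.KernelWardRelativeEnd
import Summits.QuantumFields.BalabanUV.Beta.CombChartContactFactor
import Summits.QuantumFields.BalabanUV.Beta.GAN24.WardLawParitySplit
import Summits.QuantumFields.BalabanUV.Beta.GAN24.SecondOrderReadersParity

/-!
# `BalabanUV.Beta.GAN24.CombWardLawParitySplit` — binder row G-an2-4 ∕ (CONV-C), TRANSFER-III (the (α-0) chain at row D1's literal of record (III′)),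
# LINK L3 (+ L2 (d)): **THE PARITY SPLIT OF THE BLOCK WARD LAW OF A SLOTTED W-TOWER — the EVEN half obeys the EXACT commutator identity, the ODD half carries
# the whole Ward-locus residual, the residual is tadpole-null — SLOT-GENERIC (§1), AND ITS INSTANCE AT THE COMB-CHART W-TABLES `WcombOf tabs …` of the (III′)
# literal `JsB12CombShSym` over an2's second-order Ward kernel law `WardLocusCombSecondOrder.exists_kernelLaws_WcombOf_of_letters` (§2)**
# (G-an2-4 CRUX TEAM (2), seat `b2b-balaban-gan24-p2` = road-P2 chair, gen 55; the OWNER gan24-p1 g46's (III′) link table R-gan24p1-g46-2, row «L3 law split · (III′) twin of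
# `WardResidualParity` §5 = road-P2's first refusal, INPUT = an2's (III′) second-order Ward kernel law»)

NOT IN PRINT; OUR BOOKKEEPING ([folklore] parity bookkeeping BY NAME over the OWNER gan24-p1 g33's GENERIC `GAN24.WardLawParitySplit.divW_split_of_law` ∕
`parityEven_conjV_dM_diagK`, leaf-03's `SecondOrderReadersParity.parityEven_evenHalf ∕ evenHalf_add_oddHalf`, d1-leaf-06's `WardLocusParitySplit.parityOdd_oddHalf`,
an1's `KernelWardRelativeEnd.tadpole_eq_zero_of_parity`, an2's `CombChartContactFactor.spr_GcombSh` ∕ `CombChartWardSockets.trK_GcombSh` and an2 gen 36's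
`WardLocusCombSecondOrder.exists_kernelLaws_WcombOf_of_letters`; 0 `def`, 0 cited fact, 0 `def … : Prop`, 0 sorry).
HONEST FRAMING (cell contract, verbatim): «discharging `BetaPertH` makes Bałaban's UV stability UNCONDITIONAL — a real constructive-QFT result; it is NOT the continuum
limit and NOT the Clay problem.»  HONEST DEPENDENCY (verbatim): «continuum YM on T⁴ ⇐ BetaPertH ∧ nine spine estimates (0/9 proved); BetaPertH ⇐ (D1) ∧ (D4) ∧ CAP+tail;
G-an2-4 gates asym, D1 and NE2/3/4.»
ABSOLUTE RULE (cell charter, verbatim): «No internally-minted statement may enter as a cited fact. Every hypothesis is either kernel-proved in this package or a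
verbatim quotation of a PUBLISHED theorem with page reference. The manuscript(s) under audit are NOT citable for their own disputed steps — they are the thing under
adjudication; programme-internal (2001/route/tribunal) claims are never citable.»  Nothing is cited here.

## Why (context only; asserted nowhere below)
At the chart-(II) literal (E) the (α-0) chain's link L3 is road-P2 g44's `WardResidualParity.ward_law_parity_split` — an INSTANCE, stated over
`coDressKBmAt ρ Lc (KInvStep Lc j)`, `SpureRecAt ρ`, `M1At ρ cΛ` and the (E) residual tower `vertexOfK G_j (Φ j y) + Ψ j y`.  The OWNER's memo
`TRANSFER-III-SIZING.v0_7.md` §3(a) asks to «slot the chain»: state the link ONCE over slots and meet (E) and (III′) as instances.  At (III′) the input exists: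
an2's slot-generic second-order Ward chain (`WardLocusRecursiveLettersSlot`) instantiated at the comb-chart data — `WardLocusCombSecondOrder.exists_kernelLaws_WcombOf_of_letters`:
a residual family `Nr` WITH its class and its row parity and the law `divW (WcombOf tabs … j) y ν y′ = conjV (dM G′_j Lc S′_j (tabs.M j) ν y′) (X y) + Nr j y ν y′`,
modulo the displayed table letters (V-d)(c1)(Sp)(Mp)(T2-W)(T2-B)(T2-M₂).  So the (III′) twin of L3 is a composition by name; this file types it.

## What is proved (generic `d`)
* §1 SLOT-GENERIC (any level-indexed kernels `G j`, blocking `N`, first-order tables `S j`, `M j` with parity-odd rows, any diagonal generator symbols `g y`, ANY table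
  tower `W j` and residual `Nr j` with parity-odd slices obeying `divW (W j) y ν y′ = conjV (dM (G j) N (S j) (M j) ν y′) (diagK (g y)) + Nr j y ν y′`):
  **`ward_law_parity_split_slot`** — (a) the commutator word is parity-EVEN; (b) the EVEN half `½•(W j + sgnK∘trK∘W j)` obeys the EXACT identity
  `divW (W^{ev} j) y ν y′ = conjV (dM (G j) N (S j) (M j) ν y′) (diagK (g y))`; (c) the ODD half `½•(W j − sgnK∘trK∘W j)` carries the residual: `divW (W^{od} j) y ν y′ = Nr j y ν y′`;
  **`tadpole_residual_eq_zero_slot`** — (d) a classified parity-odd residual is TADPOLE-NULL against every spread sgn-symmetric kernel (the (PAR) class of the D1 lane's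
  `SecondOrderStepRemainderWall`, the door of `WSlotParityBlind` ∕ `CombTowerEndOfSlots` §5).  The (E) file's §5 is the instance `G j := coDressKBmAt ρ Lc (KInvStep Lc j)`,
  `Nr j y ν y′ := vertexOfK G_j Lc (Φ j y) ν y′ + Ψ j y ν y′` (not re-derived here — one home per statement).
* §2 THE (III′) INSTANCE: **`exists_wardLawSplit_WcombOf`** — from ANY residual package of an2's shape (class ∧ parity ∧ law for `WcombOf tabs cE cVH cΛ cE₂ cB T`) and the
  row parities (Sp)(Mp): the package PLUS (a)–(d) at `G′_j = GcombSh Lc j` (spread `spr_GcombSh`, sgn-symmetric `trK_GcombSh`); **`exists_wardLawSplit_WcombOf_of_letters`** —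
  the same under EXACTLY the displayed letters of `WardLocusCombSecondOrder.exists_kernelLaws_WcombOf_of_letters` (pins `(cE, cVH) = (Lc^{d+1}, −Lc^{d+1}·½·Lc^{d+1})`,
  `cE₂ = Lc^{2(d+1)}`): at row D1's literal of record, as at (E), THE EVEN HALF OF THE COMB-CHART W-TOWER OBEYS THE EXACT BLOCK WARD IDENTITY at every level and the
  Ward-locus residual lives entirely in the odd half, to which the D1 consumer is blind.
WHAT THIS IS NOT: the letters (V-d)(c1)(T2-W)(T2-B)(T2-M₂) and the parities (Sp)(Mp) are DISPLAYED HYPOTHESES here exactly as in an2's law (their discharge at an1's record is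
an2's `CombChartJointEndTables*` chain and the OWNER's `CombEvenTowerAutonomy` §1 `trK_SpureCombOf` — not restated); NOT «T2Shape^{ev}» ∕ «T2Drift^{ev}» at the sym ∕ comb data
(L8), NOT one row of the S-∕W-slot, NO value, NO rate; NEVER «G-an2-4 closed» as (CONV-C); NOT D1, NOT `BetaPertH`, NOT continuum, NOT Clay.  2026-08-25; no existing file touched.
-/

noncomputable section

open Finset
open scoped BigOperators
open Literature.MathematicalPhysics.QuantumFieldTheory
open Literature.MathematicalPhysics.QuantumFieldTheory.Balaban1983to89
open Literature.MathematicalPhysics.QuantumFieldTheory.Balaban1983to89.Beta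
open ExpKernelCalculus (MKer Decays BiLoc VertexFamily VertexFamily₂ comp tadpole)
open KernelWard (divV divW)
open AffineAveraging (Site box toSite)
open AveragingContoursRooted (ctr ctrOff ctrOff_mem_box)
open OneStepResolventKernel (Fib wsum LocStencil)
open OneStepKernelFamily (KInvStep colH vertexOfK)
open BalabanStepJetsSucc (wE wVH)
open SecondOrderResponse (colM vertexOfM dM)
open BalabanStepW2 (M2Of wV4 wB2)
open StepJetData (wilsonA)
open WilsonBiStencil (wilsonW₂)
open Summit.QuantumFields.BalabanUV.Beta.TameKernelCalculus (Spr Loc trK)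
open Summit.QuantumFields.BalabanUV.Beta.ChartConjugation (conjV)
open Summit.QuantumFields.BalabanUV.Beta.BorderedHessian (bhK stepScale diagK sgnK)
open Summit.QuantumFields.BalabanUV.Beta.AveragingWardRootedStencils (legInd)
open Summit.QuantumFields.BalabanUV.Beta.WardLocusStencils (ffK)
open Summit.QuantumFields.BalabanUV.Beta.SymmetrisedStepJets (SymTables)
open Summit.QuantumFields.BalabanUV.Beta.DshAn1 (Dsh)
open Summit.QuantumFields.BalabanUV.Beta.CombChartStepJets (GcombSh ScombOf SpureCombOf WcombOf)
open Summit.QuantumFields.BalabanUV.Beta.CombChartContactFactor (spr_GcombSh)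
open Summit.QuantumFields.BalabanUV.Beta.CombChartWardSockets (trK_GcombSh)
open Summit.QuantumFields.BalabanUV.Beta.KernelWardRelativeEnd (tadpole_eq_zero_of_parity)
open Summit.QuantumFields.BalabanUV.Beta.WardLocusParitySplit (parityOdd_oddHalf)
open Summit.QuantumFields.BalabanUV.Beta.WardLocusCombSecondOrder (exists_kernelLaws_WcombOf_of_letters)
open Summit.QuantumFields.BalabanUV.Beta.GAN24.SecondOrderReadersParity (parityEven_evenHalf evenHalf_add_oddHalf)
open Summit.QuantumFields.BalabanUV.Beta.GAN24.WardLawParitySplit (divW_split_of_law parityEven_conjV_dM_diagK)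

namespace Summit.QuantumFields.BalabanUV.Beta.GAN24.CombWardLawParitySplit

variable {d : ℕ}

/-! ## §1 Slot-generic: the parity split of a block Ward law with a parity-odd residual -/

section Slot

variable {N : ℕ} {G : ℕ → MKer (d + 1) (Fib d)} {S M : ℕ → Fin (d + 1) → (Fin (d + 1) → ℤ) → MKer (d + 1) (Fib d)}
  {W : ℕ → Fin (d + 1) → (Fin (d + 1) → ℤ) → Fin (d + 1) → (Fin (d + 1) → ℤ) → MKer (d + 1) (Fib d)}
  {Nr : ℕ → (Fin (d + 1) → ℤ) → Fin (d + 1) → (Fin (d + 1) → ℤ) → MKer (d + 1) (Fib d)}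

/-- NOT IN PRINT; OUR BOOKKEEPING ([folklore]; SLOT-GENERIC L3).  **THE PARITY SPLIT OF THE BLOCK WARD LAW OF A SLOTTED W-TOWER.**  For ANY kernels `G j`, blocking `N`,
first-order tables `S j`, `M j` with parity-odd rows ((Sp)(Mp)), diagonal generator symbols `g y`, and ANY table tower `W j` obeying, at every level and every slot,
`divW (W j) y ν y′ = conjV (dM (G j) N (S j) (M j) ν y′) (diagK (g y)) + Nr j y ν y′` with a residual `Nr` whose slices are row-parity-odd:
(a) the commutator word is parity-EVEN; (b) **the EVEN half `μ u ν′ w ↦ ½•(W j μ u ν′ w + sgnK (trK (W j μ u ν′ w)))` obeys the EXACT block Ward identity** (no residual);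
(c) **the ODD half `μ u ν′ w ↦ ½•(W j μ u ν′ w − sgnK (trK (W j μ u ν′ w)))` carries the whole residual**: its block divergence IS `Nr j y ν y′`.
(The OWNER's `divW_split_of_law` at the even ∕ odd halves, `parityEven_conjV_dM_diagK`, `parityEven_evenHalf`, `parityOdd_oddHalf`.)  The (E) instance is road-P2 g44's
`WardResidualParity.ward_law_parity_split`. -/
theorem ward_law_parity_split_slot
    (hSp : ∀ (j : ℕ) (κ : Fin (d + 1)) (u : Fin (d + 1) → ℤ), trK (S j κ u) = -sgnK (S j κ u))
    (hMp : ∀ (j : ℕ) (ρ : Fin (d + 1)) (w : Fin (d + 1) → ℤ), trK (M j ρ w) = -sgnK (M j ρ w))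
    (g : (Fin (d + 1) → ℤ) → (Fin (d + 1) → ℤ) → Fib d → ℝ)
    (hNt : ∀ (j : ℕ) (y : Fin (d + 1) → ℤ) (ν : Fin (d + 1)) (y' : Fin (d + 1) → ℤ), trK (Nr j y ν y') = -sgnK (Nr j y ν y'))
    (hlaw : ∀ (j : ℕ) (y : Fin (d + 1) → ℤ) (ν : Fin (d + 1)) (y' : Fin (d + 1) → ℤ),
      divW (W j) y ν y' = conjV (dM (G j) N (S j) (M j) ν y') (diagK (g y)) + Nr j y ν y') :
    (∀ (j : ℕ) (y : Fin (d + 1) → ℤ) (ν : Fin (d + 1)) (y' : Fin (d + 1) → ℤ),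
      trK (conjV (dM (G j) N (S j) (M j) ν y') (diagK (g y))) = sgnK (conjV (dM (G j) N (S j) (M j) ν y') (diagK (g y)))) ∧
    (∀ (j : ℕ) (y : Fin (d + 1) → ℤ) (ν : Fin (d + 1)) (y' : Fin (d + 1) → ℤ),
      divW (fun μ u ν' w => (1 / 2 : ℝ) • (W j μ u ν' w + sgnK (trK (W j μ u ν' w)))) y ν y' = conjV (dM (G j) N (S j) (M j) ν y') (diagK (g y))) ∧
    (∀ (j : ℕ) (y : Fin (d + 1) → ℤ) (ν : Fin (d + 1)) (y' : Fin (d + 1) → ℤ),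
      divW (fun μ u ν' w => (1 / 2 : ℝ) • (W j μ u ν' w - sgnK (trK (W j μ u ν' w)))) y ν y' = Nr j y ν y') := by
  have hC : ∀ (j : ℕ) (y : Fin (d + 1) → ℤ) (ν : Fin (d + 1)) (y' : Fin (d + 1) → ℤ),
      trK (conjV (dM (G j) N (S j) (M j) ν y') (diagK (g y))) = sgnK (conjV (dM (G j) N (S j) (M j) ν y') (diagK (g y))) :=
    fun j y ν y' => parityEven_conjV_dM_diagK (G j) (hSp j) (hMp j) ν y' (g y)
  have hsplit : ∀ j, ∀ μ u ν' w, W j μ u ν' w =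
      (fun μ u ν' w => (1 / 2 : ℝ) • (W j μ u ν' w + sgnK (trK (W j μ u ν' w)))) μ u ν' w +
        (fun μ u ν' w => (1 / 2 : ℝ) • (W j μ u ν' w - sgnK (trK (W j μ u ν' w)))) μ u ν' w :=
    fun j μ u ν' w => (evenHalf_add_oddHalf (W j μ u ν' w)).symm
  have h := fun j y ν y' => divW_split_of_law (C := fun y ν y' => conjV (dM (G j) N (S j) (M j) ν y') (diagK (g y))) (R := Nr j)
    (hsplit j) (fun μ u ν' w => parityEven_evenHalf (W j μ u ν' w)) (fun μ u ν' w => parityOdd_oddHalf (W j μ u ν' w))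
    (hlaw j) (hC j) (hNt j) y ν y'
  exact ⟨hC, fun j y ν y' => (h j y ν y').1, fun j y ν y' => (h j y ν y').2⟩

/-- NOT IN PRINT; OUR BOOKKEEPING ([folklore]; SLOT-GENERIC L2 (d)).  **A CLASSIFIED PARITY-ODD RESIDUAL IS TADPOLE-NULL AGAINST EVERY SPREAD SGN-SYMMETRIC KERNEL**:
if every `Nr j y` is a vertex family at a positive radius and every slice is row-parity-odd, then `tadpole K (Nr j y ν y′) = 0` for EVERY `K` with `Spr K`, `trK K = sgnK K`
(an1's `tadpole_eq_zero_of_parity`) — the (PAR) class: the D1 consumer reads the W-table only through tadpoles against sgn-symmetric propagators, so it never sees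
the residual (the door `WSlotParityBlind` ∕ `CombTowerEndOfSlots` §5 walks through). -/
theorem tadpole_residual_eq_zero_slot
    (hcls : ∀ j : ℕ, ∃ C δ : ℝ, 0 < δ ∧ ∀ y, VertexFamily (Nr j y) N C δ)
    (hNt : ∀ (j : ℕ) (y : Fin (d + 1) → ℤ) (ν : Fin (d + 1)) (y' : Fin (d + 1) → ℤ), trK (Nr j y ν y') = -sgnK (Nr j y ν y'))
    {K : MKer (d + 1) (Fib d)} (hK : Spr K) (hKt : trK K = sgnK K)
    (j : ℕ) (y : Fin (d + 1) → ℤ) (ν : Fin (d + 1)) (y' : Fin (d + 1) → ℤ) :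
    tadpole K (Nr j y ν y') = 0 := by
  obtain ⟨C, δ, hδ, hV⟩ := hcls j
  exact tadpole_eq_zero_of_parity hK hKt ⟨_, _, C, δ, hδ, hV y ν y'⟩ (hNt j y ν y')

/-- NOT IN PRINT; OUR BOOKKEEPING ([folklore]; SLOT-GENERIC).  **THE ODD HALF's BLOCK DIVERGENCE IS TADPOLE-NULL** against every spread sgn-symmetric kernel, under the law
and the residual's class ∕ parity (§1 (c) ⨾ `tadpole_residual_eq_zero_slot`). -/
theorem tadpole_divW_oddHalf_eq_zero_slot
    (hSp : ∀ (j : ℕ) (κ : Fin (d + 1)) (u : Fin (d + 1) → ℤ), trK (S j κ u) = -sgnK (S j κ u))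
    (hMp : ∀ (j : ℕ) (ρ : Fin (d + 1)) (w : Fin (d + 1) → ℤ), trK (M j ρ w) = -sgnK (M j ρ w))
    (g : (Fin (d + 1) → ℤ) → (Fin (d + 1) → ℤ) → Fib d → ℝ)
    (hcls : ∀ j : ℕ, ∃ C δ : ℝ, 0 < δ ∧ ∀ y, VertexFamily (Nr j y) N C δ)
    (hNt : ∀ (j : ℕ) (y : Fin (d + 1) → ℤ) (ν : Fin (d + 1)) (y' : Fin (d + 1) → ℤ), trK (Nr j y ν y') = -sgnK (Nr j y ν y'))
    (hlaw : ∀ (j : ℕ) (y : Fin (d + 1) → ℤ) (ν : Fin (d + 1)) (y' : Fin (d + 1) → ℤ),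
      divW (W j) y ν y' = conjV (dM (G j) N (S j) (M j) ν y') (diagK (g y)) + Nr j y ν y')
    {K : MKer (d + 1) (Fib d)} (hK : Spr K) (hKt : trK K = sgnK K)
    (j : ℕ) (y : Fin (d + 1) → ℤ) (ν : Fin (d + 1)) (y' : Fin (d + 1) → ℤ) :
    tadpole K (divW (fun μ u ν' w => (1 / 2 : ℝ) • (W j μ u ν' w - sgnK (trK (W j μ u ν' w)))) y ν y') = 0 := by
  rw [(ward_law_parity_split_slot hSp hMp g hNt hlaw).2.2 j y ν y']
  exact tadpole_residual_eq_zero_slot hcls hNt hK hKt j y ν y'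

end Slot

/-! ## §2 The (III′) instance: the comb-chart W-tables `WcombOf tabs` of row D1's literal of record -/

section Comb

variable {Lc : ℕ} [NeZero Lc]

/-- NOT IN PRINT; OUR BOOKKEEPING ([folklore]; L3 AT (III′), PACKAGE FORM).  **THE WARD LAW OF THE COMB-CHART W-TOWER SPLITS BY PARITY.**  For ANY sym record
`tabs : SymTables d Lc`, ANY pins `cE cVH cΛ cE₂ cB T`, the row parities (Sp) of `SpureCombOf tabs cE cVH cΛ j` and (Mp) of `tabs.M j`, and ANY residual package of
an2's shape for `W′_j := WcombOf tabs cE cVH cΛ cE₂ cB T j` at `G′_j := GcombSh Lc j` (class ∧ parity ∧ law with generator `X y = diagK (½ • Σ_v legInd ρ_c (Lc•y+v))`):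
the package holds AND (a) the commutator word `conjV (dM G′_j Lc S′_j (tabs.M j) ν y′) (X y)` is parity-even, (b) the EVEN half of `W′_j` obeys the EXACT identity
`divW (W′^{ev} j) y ν y′ = conjV (dM G′_j Lc S′_j (tabs.M j) ν y′) (X y)`, (c) `divW (W′^{od} j) y ν y′ = Nr j y ν y′`, (d) `tadpole G′_i (Nr j y ν y′) = 0` for ALL `i j`
(`G′_i` spread `spr_GcombSh`, sgn-symmetric `trK_GcombSh`). -/
theorem exists_wardLawSplit_WcombOf (tabs : SymTables d Lc) (cE cVH cΛ cE₂ cB : ℝ) (T : Fin 4 → Fin 4 → Fin 4 → Fin 4 → ℝ)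
    (hSp : ∀ (j : ℕ) (κ : Fin (d + 1)) (u : Fin (d + 1) → ℤ), trK (SpureCombOf tabs cE cVH cΛ j κ u) = -sgnK (SpureCombOf tabs cE cVH cΛ j κ u))
    (hMp : ∀ (j : ℕ) (ρ : Fin (d + 1)) (w : Fin (d + 1) → ℤ), trK (tabs.M j ρ w) = -sgnK (tabs.M j ρ w))
    (hpkg : ∃ Nr : ℕ → (Fin (d + 1) → ℤ) → Fin (d + 1) → (Fin (d + 1) → ℤ) → MKer (d + 1) (Fib d),
      (∀ j, ∃ C δ : ℝ, 0 < δ ∧ ∀ y, VertexFamily (Nr j y) Lc C δ) ∧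
      (∀ j y ν y', trK (Nr j y ν y') = -sgnK (Nr j y ν y')) ∧
      (∀ (j : ℕ) (y : Fin (d + 1) → ℤ) (ν : Fin (d + 1)) (y' : Fin (d + 1) → ℤ),
        divW (WcombOf tabs cE cVH cΛ cE₂ cB T j) y ν y' =
          conjV (dM (GcombSh Lc j) Lc (SpureCombOf tabs cE cVH cΛ j) (tabs.M j) ν y')
            (diagK ((1 / 2 : ℝ) • ∑ v ∈ box (d + 1) Lc, legInd (ctr (d + 1) Lc) ((Lc : ℤ) • y + toSite v))) + Nr j y ν y')) :
    ∃ Nr : ℕ → (Fin (d + 1) → ℤ) → Fin (d + 1) → (Fin (d + 1) → ℤ) → MKer (d + 1) (Fib d),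
      (∀ j, ∃ C δ : ℝ, 0 < δ ∧ ∀ y, VertexFamily (Nr j y) Lc C δ) ∧
      (∀ j y ν y', trK (Nr j y ν y') = -sgnK (Nr j y ν y')) ∧
      (∀ (j : ℕ) (y : Fin (d + 1) → ℤ) (ν : Fin (d + 1)) (y' : Fin (d + 1) → ℤ),
        divW (WcombOf tabs cE cVH cΛ cE₂ cB T j) y ν y' =
          conjV (dM (GcombSh Lc j) Lc (SpureCombOf tabs cE cVH cΛ j) (tabs.M j) ν y')
            (diagK ((1 / 2 : ℝ) • ∑ v ∈ box (d + 1) Lc, legInd (ctr (d + 1) Lc) ((Lc : ℤ) • y + toSite v))) + Nr j y ν y') ∧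
      (∀ (j : ℕ) (y : Fin (d + 1) → ℤ) (ν : Fin (d + 1)) (y' : Fin (d + 1) → ℤ),
        trK (conjV (dM (GcombSh Lc j) Lc (SpureCombOf tabs cE cVH cΛ j) (tabs.M j) ν y')
            (diagK ((1 / 2 : ℝ) • ∑ v ∈ box (d + 1) Lc, legInd (ctr (d + 1) Lc) ((Lc : ℤ) • y + toSite v))))
          = sgnK (conjV (dM (GcombSh Lc j) Lc (SpureCombOf tabs cE cVH cΛ j) (tabs.M j) ν y')
            (diagK ((1 / 2 : ℝ) • ∑ v ∈ box (d + 1) Lc, legInd (ctr (d + 1) Lc) ((Lc : ℤ) • y + toSite v))))) ∧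
      (∀ (j : ℕ) (y : Fin (d + 1) → ℤ) (ν : Fin (d + 1)) (y' : Fin (d + 1) → ℤ),
        divW (fun μ u ν' w => (1 / 2 : ℝ) • (WcombOf tabs cE cVH cΛ cE₂ cB T j μ u ν' w + sgnK (trK (WcombOf tabs cE cVH cΛ cE₂ cB T j μ u ν' w)))) y ν y' =
          conjV (dM (GcombSh Lc j) Lc (SpureCombOf tabs cE cVH cΛ j) (tabs.M j) ν y')
            (diagK ((1 / 2 : ℝ) • ∑ v ∈ box (d + 1) Lc, legInd (ctr (d + 1) Lc) ((Lc : ℤ) • y + toSite v)))) ∧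
      (∀ (j : ℕ) (y : Fin (d + 1) → ℤ) (ν : Fin (d + 1)) (y' : Fin (d + 1) → ℤ),
        divW (fun μ u ν' w => (1 / 2 : ℝ) • (WcombOf tabs cE cVH cΛ cE₂ cB T j μ u ν' w - sgnK (trK (WcombOf tabs cE cVH cΛ cE₂ cB T j μ u ν' w)))) y ν y' =
          Nr j y ν y') ∧
      (∀ (i j : ℕ) (y : Fin (d + 1) → ℤ) (ν : Fin (d + 1)) (y' : Fin (d + 1) → ℤ), tadpole (GcombSh (d := d) Lc i) (Nr j y ν y') = 0) := by
  obtain ⟨Nr, hcls, hNt, hlaw⟩ := hpkg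
  have h := ward_law_parity_split_slot (G := GcombSh Lc) (S := SpureCombOf tabs cE cVH cΛ) (M := tabs.M) (W := WcombOf tabs cE cVH cΛ cE₂ cB T)
    (Nr := Nr) hSp hMp (fun y => (1 / 2 : ℝ) • ∑ v ∈ box (d + 1) Lc, legInd (ctr (d + 1) Lc) ((Lc : ℤ) • y + toSite v)) hNt hlaw
  exact ⟨Nr, hcls, hNt, hlaw, h.1, h.2.1, h.2.2,
    fun i j y ν y' => tadpole_residual_eq_zero_slot hcls hNt (spr_GcombSh (Lc := Lc) i) (trK_GcombSh (Lc := Lc) i) j y ν y'⟩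


/-- NOT IN PRINT; OUR BOOKKEEPING ([folklore]; **L3 AT ROW D1's LITERAL OF RECORD (III′)**).  **THE BLOCK WARD LAW OF THE COMB-CHART W-TOWER `WcombOf tabs …` SPLITS BY
PARITY, FROM an2's TABLE LETTERS** — `WardLocusCombSecondOrder.exists_kernelLaws_WcombOf_of_letters` (generic `d`; pins of record `(cE, cVH) = (Lc^{d+1}, −Lc^{d+1}·½·Lc^{d+1})`,
`cE₂ = Lc^{2(d+1)}`, root `ρ_c`, generator `X y = diagK (½ • Σ_v legInd ρ_c (Lc•y+v))`; DISPLAYED exactly as there: (V-d), (c1) at `G′`, (Sp)(Mp), (T2-W)(T2-B)(T2-M₂) with their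
remainders' classes and parities) composed with §2's `exists_wardLawSplit_WcombOf`: there is a residual family `Nr` — classified, row-parity-odd — with an2's law AND
(a) the commutator word parity-EVEN, (b) **`divW (½•(W′_j + sgnK∘trK∘W′_j)) y ν y′ = conjV (dM G′_j Lc S′_j (tabs.M j) ν y′) (X y)` — THE EVEN HALF OF THE (III′) W-TOWER OBEYS THE
EXACT BLOCK WARD IDENTITY AT EVERY LEVEL**, (c) `divW (½•(W′_j − sgnK∘trK∘W′_j)) y ν y′ = Nr j y ν y′`, (d) `tadpole G′_i (Nr j y ν y′) = 0` for all `i j` — the (III′) twin of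
road-P2 g44's `WardResidualParity.ward_law_parity_split` ∕ `parityOdd_residual_tower` (d). -/
theorem exists_wardLawSplit_WcombOf_of_letters (tabs : SymTables d Lc)
    -- the border letter (V-d) of `tabs.V` against an1's typed legged border
    (hVd : ∀ u : Fin (d + 1) → ℤ, conjV (bhK Lc + Dsh Lc) (diagK (legInd (ctr (d + 1) Lc) u)) =
      conjV (ffK (bhK (d := d) Lc)) (diagK (legInd (ctr (d + 1) Lc) u)) - ((Lc : ℝ) ^ (d + 1)) • divV tabs.V u)
    (cΛ cB : ℝ) {cE₂ : ℝ} (hcE₂ : cE₂ = (Lc : ℝ) ^ (2 * (d + 1))) (T : Fin 4 → Fin 4 → Fin 4 → Fin 4 → ℝ)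
    -- (c1) the order-one consistency of the multiplier table with the Λ-sector, every level
    (hc1 : ∀ (j : ℕ) (κ : Fin (d + 1)) (u : Fin (d + 1) → ℤ),
      dM (GcombSh Lc j) Lc (SpureCombOf tabs ((Lc : ℝ) ^ (d + 1)) (-((Lc : ℝ) ^ (d + 1) * (1 / 2) * (Lc : ℝ) ^ (d + 1))) cΛ j) (tabs.M j) κ u = vertexOfK (GcombSh Lc j) Lc (ScombOf tabs ((Lc : ℝ) ^ (d + 1)) (-((Lc : ℝ) ^ (d + 1) * (1 / 2) * (Lc : ℝ) ^ (d + 1))) cΛ j) κ u)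
    -- (Sp)(Mp) the row parities of the first-order tables
    (hSp : ∀ (j : ℕ) (κ : Fin (d + 1)) (u : Fin (d + 1) → ℤ), trK (SpureCombOf tabs ((Lc : ℝ) ^ (d + 1)) (-((Lc : ℝ) ^ (d + 1) * (1 / 2) * (Lc : ℝ) ^ (d + 1))) cΛ j κ u) = -sgnK (SpureCombOf tabs ((Lc : ℝ) ^ (d + 1)) (-((Lc : ℝ) ^ (d + 1) * (1 / 2) * (Lc : ℝ) ^ (d + 1))) cΛ j κ u))
    (hMp : ∀ (j : ℕ) (ρ : Fin (d + 1)) (w : Fin (d + 1) → ℤ), trK (tabs.M j ρ w) = -sgnK (tabs.M j ρ w))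
    -- the LETTERS' remainders, their classes (one rate per level) and row parities
    {RW RW'' : (Fin (d + 1) → ℤ) → Fin (d + 1) → (Fin (d + 1) → ℤ) → MKer (d + 1) (Fib d)}
    {RB RB'' : ℕ → (Fin (d + 1) → ℤ) → Fin (d + 1) → (Fin (d + 1) → ℤ) → MKer (d + 1) (Fib d)}
    {RM : ℕ → (Fin (d + 1) → ℤ) → Fin (d + 1) → (Fin (d + 1) → ℤ) → MKer (d + 1) (Fib d)}
    (hcls0 : ∃ C δ : ℝ, 0 < δ ∧ (∀ Y, LocStencil (RW Y) C δ) ∧ (∀ Y, LocStencil (RW'' Y) C δ) ∧ (∀ Y, LocStencil (RB 0 Y) C δ) ∧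
      (∀ Y, LocStencil (RB'' 0 Y) C δ) ∧ (∀ y, VertexFamily (RM 0 y) Lc C δ))
    (hclsS : ∀ j : ℕ, ∃ C δ : ℝ, 0 < δ ∧ (∀ Y, LocStencil (RB (j + 1) Y) C δ) ∧ (∀ Y, LocStencil (RB'' (j + 1) Y) C δ) ∧
      (∀ y, VertexFamily (RM (j + 1) y) Lc C δ))
    (hRWp : ∀ Y κ u, trK (RW Y κ u) = -sgnK (RW Y κ u)) (hRW''p : ∀ Y κ u, trK (RW'' Y κ u) = -sgnK (RW'' Y κ u))
    (hRBp : ∀ j Y κ u, trK (RB j Y κ u) = -sgnK (RB j Y κ u)) (hRB''p : ∀ j Y κ u, trK (RB'' j Y κ u) = -sgnK (RB'' j Y κ u))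
    (hRMp : ∀ j y ρ' w, trK (RM j y ρ' w) = -sgnK (RM j y ρ' w))
    -- (T2-W) the level-0 Wilson Ward law, both slots
    (hWil : ∀ (Y : Fin (d + 1) → ℤ) (κ' : Fin (d + 1)) (u' : Fin (d + 1) → ℤ),
      (stepScale d Lc 0 * (Lc : ℝ) ^ (d + 1))⁻¹ • ∑ v ∈ box (d + 1) Lc, divV (fun κ u => cE₂ • wilsonW₂ d T κ u κ' u') ((Lc : ℤ) • Y + toSite v) =
        comp (((Lc : ℝ) ^ (d + 1)) • wilsonA d κ' u') (diagK ((1 / 2 : ℝ) • ∑ v ∈ box (d + 1) Lc, legInd (ctr (d + 1) Lc) ((Lc : ℤ) • Y + toSite v)))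
          - comp (diagK ((1 / 2 : ℝ) • ∑ v ∈ box (d + 1) Lc, legInd (ctr (d + 1) Lc) ((Lc : ℤ) • Y + toSite v))) (((Lc : ℝ) ^ (d + 1)) • wilsonA d κ' u') + RW Y κ' u')
    (hWil'' : ∀ (Y : Fin (d + 1) → ℤ) (κ : Fin (d + 1)) (u : Fin (d + 1) → ℤ),
      (stepScale d Lc 0 * (Lc : ℝ) ^ (d + 1))⁻¹ • ∑ v ∈ box (d + 1) Lc, divV (fun κ' u' => cE₂ • wilsonW₂ d T κ u κ' u') ((Lc : ℤ) • Y + toSite v) =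
        comp (((Lc : ℝ) ^ (d + 1)) • wilsonA d κ u) (diagK ((1 / 2 : ℝ) • ∑ v ∈ box (d + 1) Lc, legInd (ctr (d + 1) Lc) ((Lc : ℤ) • Y + toSite v)))
          - comp (diagK ((1 / 2 : ℝ) • ∑ v ∈ box (d + 1) Lc, legInd (ctr (d + 1) Lc) ((Lc : ℤ) • Y + toSite v))) (((Lc : ℝ) ^ (d + 1)) • wilsonA d κ u) + RW'' Y κ u)
    -- (T2-B) the border Ward law of `tabs.vh₂S` against `tabs.V`, both slots, level 0 and level j+1
    (hBord0 : ∀ (Y : Fin (d + 1) → ℤ) (κ' : Fin (d + 1)) (u' : Fin (d + 1) → ℤ),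
      (stepScale d Lc 0 * (Lc : ℝ) ^ (d + 1))⁻¹ • ∑ v ∈ box (d + 1) Lc, divV (fun κ u => cB • tabs.vh₂S κ u κ' u') ((Lc : ℤ) • Y + toSite v) =
        comp ((-((Lc : ℝ) ^ (d + 1) * (1 / 2) * (Lc : ℝ) ^ (d + 1))) • tabs.V κ' u') (diagK ((1 / 2 : ℝ) • ∑ v ∈ box (d + 1) Lc, legInd (ctr (d + 1) Lc) ((Lc : ℤ) • Y + toSite v)))
          - comp (diagK ((1 / 2 : ℝ) • ∑ v ∈ box (d + 1) Lc, legInd (ctr (d + 1) Lc) ((Lc : ℤ) • Y + toSite v))) ((-((Lc : ℝ) ^ (d + 1) * (1 / 2) * (Lc : ℝ) ^ (d + 1))) • tabs.V κ' u') + RB 0 Y κ' u')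
    (hBord0'' : ∀ (Y : Fin (d + 1) → ℤ) (κ : Fin (d + 1)) (u : Fin (d + 1) → ℤ),
      (stepScale d Lc 0 * (Lc : ℝ) ^ (d + 1))⁻¹ • ∑ v ∈ box (d + 1) Lc, divV (fun κ' u' => cB • tabs.vh₂S κ u κ' u') ((Lc : ℤ) • Y + toSite v) =
        comp ((-((Lc : ℝ) ^ (d + 1) * (1 / 2) * (Lc : ℝ) ^ (d + 1))) • tabs.V κ u) (diagK ((1 / 2 : ℝ) • ∑ v ∈ box (d + 1) Lc, legInd (ctr (d + 1) Lc) ((Lc : ℤ) • Y + toSite v)))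
          - comp (diagK ((1 / 2 : ℝ) • ∑ v ∈ box (d + 1) Lc, legInd (ctr (d + 1) Lc) ((Lc : ℤ) • Y + toSite v))) ((-((Lc : ℝ) ^ (d + 1) * (1 / 2) * (Lc : ℝ) ^ (d + 1))) • tabs.V κ u) + RB'' 0 Y κ u)
    (hBordS : ∀ (j : ℕ) (Y : Fin (d + 1) → ℤ) (κ' : Fin (d + 1)) (u' : Fin (d + 1) → ℤ),
      (stepScale d Lc (j + 1) * (Lc : ℝ) ^ (d + 1))⁻¹ • ∑ v ∈ box (d + 1) Lc, divV (fun κ u => (cB * wB2 d Lc (j + 1)) • tabs.vh₂S κ u κ' u') ((Lc : ℤ) • Y + toSite v) =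
        comp (((-((Lc : ℝ) ^ (d + 1) * (1 / 2) * (Lc : ℝ) ^ (d + 1))) * wVH d Lc (j + 1)) • tabs.V κ' u') (diagK ((1 / 2 : ℝ) • ∑ v ∈ box (d + 1) Lc, legInd (ctr (d + 1) Lc) ((Lc : ℤ) • Y + toSite v)))
          - comp (diagK ((1 / 2 : ℝ) • ∑ v ∈ box (d + 1) Lc, legInd (ctr (d + 1) Lc) ((Lc : ℤ) • Y + toSite v))) (((-((Lc : ℝ) ^ (d + 1) * (1 / 2) * (Lc : ℝ) ^ (d + 1))) * wVH d Lc (j + 1)) • tabs.V κ' u') + RB (j + 1) Y κ' u')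
    (hBordS'' : ∀ (j : ℕ) (Y : Fin (d + 1) → ℤ) (κ : Fin (d + 1)) (u : Fin (d + 1) → ℤ),
      (stepScale d Lc (j + 1) * (Lc : ℝ) ^ (d + 1))⁻¹ • ∑ v ∈ box (d + 1) Lc, divV (fun κ' u' => (cB * wB2 d Lc (j + 1)) • tabs.vh₂S κ u κ' u') ((Lc : ℤ) • Y + toSite v) =
        comp (((-((Lc : ℝ) ^ (d + 1) * (1 / 2) * (Lc : ℝ) ^ (d + 1))) * wVH d Lc (j + 1)) • tabs.V κ u) (diagK ((1 / 2 : ℝ) • ∑ v ∈ box (d + 1) Lc, legInd (ctr (d + 1) Lc) ((Lc : ℤ) • Y + toSite v)))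
          - comp (diagK ((1 / 2 : ℝ) • ∑ v ∈ box (d + 1) Lc, legInd (ctr (d + 1) Lc) ((Lc : ℤ) • Y + toSite v))) (((-((Lc : ℝ) ^ (d + 1) * (1 / 2) * (Lc : ℝ) ^ (d + 1))) * wVH d Lc (j + 1)) • tabs.V κ u) + RB'' (j + 1) Y κ u)
    -- (T2-M₂) the mixed Ward law of `M2Of tabs.mixFF j` against `tabs.M j`, every level
    (hM₂ : ∀ (j : ℕ) (y : Fin (d + 1) → ℤ) (ρ' : Fin (d + 1)) (w : Fin (d + 1) → ℤ),
      (stepScale d Lc j * (Lc : ℝ) ^ (d + 1))⁻¹ • ∑ v ∈ box (d + 1) Lc, divV (fun κ u => M2Of d Lc tabs.mixFF j κ u ρ' w) ((Lc : ℤ) • y + toSite v) =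
        comp (tabs.M j ρ' w) (diagK ((1 / 2 : ℝ) • ∑ v ∈ box (d + 1) Lc, legInd (ctr (d + 1) Lc) ((Lc : ℤ) • y + toSite v))) - comp (diagK ((1 / 2 : ℝ) • ∑ v ∈ box (d + 1) Lc, legInd (ctr (d + 1) Lc) ((Lc : ℤ) • y + toSite v))) (tabs.M j ρ' w) + RM j y ρ' w) :
    ∃ Nr : ℕ → (Fin (d + 1) → ℤ) → Fin (d + 1) → (Fin (d + 1) → ℤ) → MKer (d + 1) (Fib d),
      (∀ j, ∃ C δ : ℝ, 0 < δ ∧ ∀ y, VertexFamily (Nr j y) Lc C δ) ∧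
      (∀ j y ν y', trK (Nr j y ν y') = -sgnK (Nr j y ν y')) ∧
      (∀ (j : ℕ) (y : Fin (d + 1) → ℤ) (ν : Fin (d + 1)) (y' : Fin (d + 1) → ℤ),
        divW (WcombOf tabs ((Lc : ℝ) ^ (d + 1)) (-((Lc : ℝ) ^ (d + 1) * (1 / 2) * (Lc : ℝ) ^ (d + 1))) cΛ cE₂ cB T j) y ν y' =
          conjV (dM (GcombSh Lc j) Lc (SpureCombOf tabs ((Lc : ℝ) ^ (d + 1)) (-((Lc : ℝ) ^ (d + 1) * (1 / 2) * (Lc : ℝ) ^ (d + 1))) cΛ j) (tabs.M j) ν y')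
            (diagK ((1 / 2 : ℝ) • ∑ v ∈ box (d + 1) Lc, legInd (ctr (d + 1) Lc) ((Lc : ℤ) • y + toSite v))) + Nr j y ν y') ∧
      (∀ (j : ℕ) (y : Fin (d + 1) → ℤ) (ν : Fin (d + 1)) (y' : Fin (d + 1) → ℤ),
        trK (conjV (dM (GcombSh Lc j) Lc (SpureCombOf tabs ((Lc : ℝ) ^ (d + 1)) (-((Lc : ℝ) ^ (d + 1) * (1 / 2) * (Lc : ℝ) ^ (d + 1))) cΛ j) (tabs.M j) ν y')
            (diagK ((1 / 2 : ℝ) • ∑ v ∈ box (d + 1) Lc, legInd (ctr (d + 1) Lc) ((Lc : ℤ) • y + toSite v))))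
          = sgnK (conjV (dM (GcombSh Lc j) Lc (SpureCombOf tabs ((Lc : ℝ) ^ (d + 1)) (-((Lc : ℝ) ^ (d + 1) * (1 / 2) * (Lc : ℝ) ^ (d + 1))) cΛ j) (tabs.M j) ν y')
            (diagK ((1 / 2 : ℝ) • ∑ v ∈ box (d + 1) Lc, legInd (ctr (d + 1) Lc) ((Lc : ℤ) • y + toSite v))))) ∧
      (∀ (j : ℕ) (y : Fin (d + 1) → ℤ) (ν : Fin (d + 1)) (y' : Fin (d + 1) → ℤ),
        divW (fun μ u ν' w => (1 / 2 : ℝ) • (WcombOf tabs ((Lc : ℝ) ^ (d + 1)) (-((Lc : ℝ) ^ (d + 1) * (1 / 2) * (Lc : ℝ) ^ (d + 1))) cΛ cE₂ cB T j μ u ν' w + sgnK (trK (WcombOf tabs ((Lc : ℝ) ^ (d + 1)) (-((Lc : ℝ) ^ (d + 1) * (1 / 2) * (Lc : ℝ) ^ (d + 1))) cΛ cE₂ cB T j μ u ν' w)))) y ν y' =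
          conjV (dM (GcombSh Lc j) Lc (SpureCombOf tabs ((Lc : ℝ) ^ (d + 1)) (-((Lc : ℝ) ^ (d + 1) * (1 / 2) * (Lc : ℝ) ^ (d + 1))) cΛ j) (tabs.M j) ν y')
            (diagK ((1 / 2 : ℝ) • ∑ v ∈ box (d + 1) Lc, legInd (ctr (d + 1) Lc) ((Lc : ℤ) • y + toSite v)))) ∧
      (∀ (j : ℕ) (y : Fin (d + 1) → ℤ) (ν : Fin (d + 1)) (y' : Fin (d + 1) → ℤ),
        divW (fun μ u ν' w => (1 / 2 : ℝ) • (WcombOf tabs ((Lc : ℝ) ^ (d + 1)) (-((Lc : ℝ) ^ (d + 1) * (1 / 2) * (Lc : ℝ) ^ (d + 1))) cΛ cE₂ cB T j μ u ν' w - sgnK (trK (WcombOf tabs ((Lc : ℝ) ^ (d + 1)) (-((Lc : ℝ) ^ (d + 1) * (1 / 2) * (Lc : ℝ) ^ (d + 1))) cΛ cE₂ cB T j μ u ν' w)))) y ν y' =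
          Nr j y ν y') ∧
      (∀ (i j : ℕ) (y : Fin (d + 1) → ℤ) (ν : Fin (d + 1)) (y' : Fin (d + 1) → ℤ), tadpole (GcombSh (d := d) Lc i) (Nr j y ν y') = 0) :=
  exists_wardLawSplit_WcombOf tabs _ _ cΛ cE₂ cB T hSp hMp
    (exists_kernelLaws_WcombOf_of_letters tabs hVd cΛ cB hcE₂ T hc1 hSp hMp hcls0 hclsS hRWp hRW''p hRBp hRB''p hRMp hWil hWil'' hBord0 hBord0'' hBordS hBordS'' hM₂)

end Comb

end Summit.QuantumFields.BalabanUV.Beta.GAN24.CombWardLawParitySplit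

end
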